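import Summits.QuantumFields.YangMills.Theorems.UnitScaleTiltProp7MassiveSolutionGradientSupAllMembers
import Summits.QuantumFields.YangMills.Theorems.UnitScaleTiltProp7ResolventHolderRowMember
import Summits.QuantumFields.YangMills.Theorems.UnitScaleTiltProp7TwoBackgroundGradientComparison
import HarnessLib

/-!
# Route `UnitScaleTilt`, crux K1 «MinimiserStabilityRegPr» (stmt-QuantumFields-19200), EX face, STOREY H (row (5) `h3` ∕ H2):
# **THE GRADIENT LETTER `Hgrad⁰` OF `G_m = (Δ^η_V + m)⁻¹` ON SUP DATA, DISCHARGED AT EVERY MEMBER** (chair WORD №56 (R1), px19 g15's residue (i))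

[Balaban1985BackgroundPropagators] Thm 3.1, p. 397 («`|∇_U G(1)f| ≤ O(1)·sup|f|`» for the massive covariant Green's function on the unit lattice,
(3.42)–(3.44)) needs two ingredients at a member `(F, n, K)` of the `T³` family: (a) the SUP of `u = G_m g` from the sup of `g` — the discrete
MAXIMUM PRINCIPLE for the covariant lattice Laplacian `Δ^η_V = D*_V D_V` (its off-diagonal stencil entries are the unitary transporters `Ad V(b)^{±1}`,
so only norms enter: `(m + 6η⁻²)‖u(y₀)‖ ≤ ‖g(y₀)‖ + η⁻²·Σ‖u(y₀ ± e_μ)‖` at a maximiser `y₀`), giving `sup‖u‖ ≤ sup‖g‖∕m` with NO constant; (b) the sup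
GRADIENT of a solution of `Δ^η_V u + q = 0` from the sups of `u` and `q` — px19∕px5's T1-core ✓`Prop7MassiveSolutionGradientSupAllMembers.norm_equiv_DL2_le_of_sup_allMembers`
(every member, no no-wrap room), here with `q := m·u − g`.

WHAT IS PROVED (namespace `Summit.QuantumFields.YangMills.Theorems.Prop7GreenSupGradientRowAllMembers`; THEOREMS ONLY, 0 `def`, 0 `sorry`, default heartbeats).
* §1 `equiv_covLapSite_stencil` — the pointwise stencil of `Δ^η_V` read through `WL2.equiv`:
  `(Δ^η_V u)(y) = η⁻¹•Σ_μ η⁻¹•((u y − Ad(V(y−e_μ,μ))⁻¹ u(y−e_μ)) − (Ad V(y,μ) u(y+e_μ) − u y))` ((3.3), (3.8), (3.23); `Ad⁻¹Ad = 1`).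
* §2 ★★ `norm_equiv_le_of_massive` — THE MAXIMUM PRINCIPLE: `Δ^η_V u + m•u = g`, `m > 0`, `‖g(y)‖ ≤ G_s` ⟹ `‖u(y)‖ ≤ G_s∕m` for all `y`; and
  ★★ `norm_equiv_greenK_le` — the same for `u := greenK (Δ^η_V + m) g`.  ANY background `V`, no regularity, no room.
* §3 ★★★ `Hgrad_of_regPr_allMembers` — for `RegPr F n K ε₀ V` (`0 < ε₀ ≤ 1`) under T1-core's margin `C_g·(48ε₀(6√2√10 + 6√2)) ≤ ½`, every `m > 0`:
  `∀ g G_s, 0 ≤ G_s → (∀ y, ‖g y‖ ≤ G_s) → ∀ b, ‖(D_V G_m g)(b)‖ ≤ Θ_g(m)·G_s` with the EXPLICIT, K-FREE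
  `Θ_g(m) := 2·(C_g·((2 + X)∕m + 2) + 2√2·48ε₀∕m)`, `X := 2√2·4ε₀(3 + 2457C) + (24√10 + 48)(48ε₀)²` (`C_g`, `C` the cell's pinned local-gradient constants);
  ★★★ `Hgrad_one_of_regPr_allMembers` — the `m = 1` edition, stated as the `Hgrad` binder of ✓`Prop7FlatResolventHolderLetterMember.holderRow_G1_DstarL2_of_gauge_and_grad`
  ∕ ✓`Prop7ResolventHolderRowMember.holderRow_resolventDstarL2_unweighted` TOKEN FOR TOKEN (`greenK (covLapSite … V + ((1 : ℝ) : ℂ) • LinearMap.id) (covLapSite_add_pos … V one_pos) g`)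
  with `Θg := 2·(C_g·(4 + X) + 2√2·48ε₀)`.
HYPOTHESES.  `RegPr` is print's regularity (8) of the background (gauge-INVARIANT, ✓`regPr_gaugeAct_iff`, and cover-stable, ✓`regPr_cover_iff` — so the letter is
available at the locally re-gauged backgrounds of chair №53's pipeline); the margin is T1-core's (cap-type, `ε₀ ≤` an absolute constant).  No no-wrap room, no global gauge letter.
HONEST SCOPE.  A helper letter; nothing of H2 FILE 2, `h3`, norm_G, the EX display, EX `stub_existenceMinimalOrbit`, stmt-19200 or R3 is proved here; no summit is proved by a helper.

Cell `ym3-torus` (HUMAN RULING D-0037; rung R3 = SU(2) YM₃ on T³ — NOT d = 4, NOT infinite volume, NOT a mass gap, NOT Clay).  Width seat `ym3-torus-px5` (g15), 2026-08-30;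
`--supports stmt-QuantumFields-19200 --as helper`; count-neutral.

References: T. Bałaban, *Propagators for lattice gauge theories in a background field*, CMP **99** (1985) 389–434 [Balaban1985BackgroundPropagators] ((3.3) p.391, (3.8) p.392,
(3.23) p.394, (3.36)–(3.38) p.396, Thm 3.1 (3.42)–(3.44) pp.397–398); *Propagators and renormalization transformations II*, CMP **96** (1984) 223–250 [Balaban1984PropagatorsII]
(Lemma 2.1 p.234); *The variational problem…*, CMP **102** (1985) 277–309 [Balaban1985Variational] ((8) p.278).
-/

set_option autoImplicit false

noncomputable section

open scoped InnerProductSpace ComplexConjugate BigOperators Matrix.Norms.L2Operator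

namespace Summit.QuantumFields.YangMills.Theorems.Prop7GreenSupGradientRowAllMembers

open Literature.MathematicalPhysics.QuantumFieldTheory.Balaban1983to89
open Literature.MathematicalPhysics.QuantumFieldTheory.Balaban1983to89.T3ContinuumYM3Torus
open B4Sect5Torus (TSite)
open B9SectCLatticeCarrier (Bond shift unshift shift_unshift)
open B9Eq311L2Pairing (WL2)
open B11Eq103H1Complex (SiteL2K BondL2K greenK apply_greenK)
open T3SectALandauChart (eta eta_pos)
open T3PrintedRegularMinimiser (RegPr)
open Summit.QuantumFields.YangMills.Theorems.Prop7SectET3Transport (periodsT3)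
open Summit.QuantumFields.YangMills.Theorems.Prop7SectET3HilbertLetters (W₂ adBg adBgInv DL2 DstarL2 covLapSite)
open Summit.QuantumFields.YangMills.Theorems.Prop7KatoBootstrapMember (norm_adBg_eq norm_adBgInv_eq adBgInv_adBg)
open Summit.QuantumFields.YangMills.Theorems.Prop7ResolventHolderRowMember (covLapSite_add_pos two_le_periodsT3)
open Summit.QuantumFields.YangMills.Theorems.Prop7TwoBackgroundGradientComparison (equiv_DL2_apply equiv_DstarL2_apply covLapSite_apply norm_inv_eta)
open Summit.QuantumFields.YangMills.Theorems.Prop7CurvedMemberLocalGradient (exists_curved_localGradient)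
open Summit.QuantumFields.YangMills.Theorems.AxialGaugeChartGlue (norm_bgOfCfg_axialT_sub_le)
open Summit.QuantumFields.YangMills.Theorems.Prop7MassiveSolutionGradientSupAllMembers (norm_equiv_DL2_le_of_sup_allMembers)

variable (F : T3Family) (n K : ℕ) (c₀ : ℝ) [Fact (0 < c₀)]

/-! ## §1 The pointwise stencil of the covariant Laplacian -/

/-- **THE STENCIL OF `Δ^η_V = D*_V D_V` AT A SITE**: `(Δ^η_V u)(y) = η⁻¹•Σ_μ η⁻¹•((u y − Ad(V(y−e_μ,μ))⁻¹ u(y−e_μ)) − (Ad V(y,μ) u(y+e_μ) − u y))` — (3.23) composed of the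
stencils (3.3) and (3.8), with `Ad(V_b)⁻¹ Ad(V_b) = 1` on the backward term. [cite: Balaban1985BackgroundPropagators, (3.3) p.391, (3.8) p.392, (3.23) p.394] -/
theorem equiv_covLapSite_stencil (V : GaugeField (F.P K) 0 (Matrix.specialUnitaryGroup (Fin 2) ℂ)) (u : SiteL2K ℂ 3 (periodsT3 F K) c₀ W₂)
    (y : TSite 3 (periodsT3 F K)) :
    WL2.equiv ℂ (fun _ : TSite 3 (periodsT3 F K) => c₀) W₂ (covLapSite F n K c₀ V u) y =
      ((((eta F n K : ℝ) : ℂ))⁻¹) • ∑ μ : Fin 3,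
        (((((eta F n K : ℝ) : ℂ))⁻¹) • (WL2.equiv ℂ (fun _ : TSite 3 (periodsT3 F K) => c₀) W₂ u y
              - adBgInv F K V (unshift μ y, μ) (WL2.equiv ℂ (fun _ : TSite 3 (periodsT3 F K) => c₀) W₂ u (unshift μ y)))
          - ((((eta F n K : ℝ) : ℂ))⁻¹) • (adBg F K V (y, μ) (WL2.equiv ℂ (fun _ : TSite 3 (periodsT3 F K) => c₀) W₂ u (shift μ y))
              - WL2.equiv ℂ (fun _ : TSite 3 (periodsT3 F K) => c₀) W₂ u y)) := by
  rw [covLapSite_apply, equiv_DstarL2_apply]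
  congr 1
  refine Finset.sum_congr rfl fun μ _ => ?_
  rw [equiv_DL2_apply, equiv_DL2_apply, shift_unshift, map_smul, map_sub, adBgInv_adBg]

/-! ## §2 ★★ The maximum principle for `Δ^η_V + m` -/

/-- ★★ **THE DISCRETE MAXIMUM PRINCIPLE FOR THE MASSIVE COVARIANT LAPLACIAN** (any background `V`, no regularity, no room): if `Δ^η_V u + m•u = g` with `m > 0` and
`‖g(y)‖ ≤ G_s` everywhere, then `‖u(y)‖ ≤ G_s∕m` everywhere.  At a maximiser `y₀` of `‖u(·)‖` the stencil gives `(m + 6η⁻²)•u(y₀) = g(y₀) + η⁻²•Σ_μ (Ad⁻¹u(y₀−e_μ) + Ad u(y₀+e_μ))`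
and the transporters are isometries. [cite: Balaban1985BackgroundPropagators, (3.23) p.394, (3.36)-(3.38) p.396, Thm 3.1 p.397] -/
theorem norm_equiv_le_of_massive (V : GaugeField (F.P K) 0 (Matrix.specialUnitaryGroup (Fin 2) ℂ)) {m : ℝ} (hm : 0 < m)
    (u g : SiteL2K ℂ 3 (periodsT3 F K) c₀ W₂) (h : covLapSite F n K c₀ V u + (m : ℂ) • u = g) {Gs : ℝ}
    (hg : ∀ y, ‖WL2.equiv ℂ (fun _ : TSite 3 (periodsT3 F K) => c₀) W₂ g y‖ ≤ Gs) :
    ∀ y, ‖WL2.equiv ℂ (fun _ : TSite 3 (periodsT3 F K) => c₀) W₂ u y‖ ≤ Gs / m := by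
  classical
  -- a maximiser of `‖u ·‖`
  have hne : (Finset.univ : Finset (TSite 3 (periodsT3 F K))).Nonempty :=
    ⟨fun i => ⟨0, by have := two_le_periodsT3 F K i; omega⟩, Finset.mem_univ _⟩
  obtain ⟨y₀, -, hy₀⟩ := Finset.exists_max_image Finset.univ
    (fun y => ‖WL2.equiv ℂ (fun _ : TSite 3 (periodsT3 F K) => c₀) W₂ u y‖) hne
  have hmax : ∀ y, ‖WL2.equiv ℂ (fun _ : TSite 3 (periodsT3 F K) => c₀) W₂ u y‖
      ≤ ‖WL2.equiv ℂ (fun _ : TSite 3 (periodsT3 F K) => c₀) W₂ u y₀‖ := fun y => hy₀ y (Finset.mem_univ y)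
  -- the equation at `y₀`, stencil form
  have hpt := congrArg (fun v => WL2.equiv ℂ (fun _ : TSite 3 (periodsT3 F K) => c₀) W₂ v y₀) h
  simp only [WL2.equiv_add, WL2.equiv_smul, Pi.add_apply, Pi.smul_apply] at hpt
  rw [equiv_covLapSite_stencil, Fin.sum_univ_three] at hpt
  -- letters (introduced now, so that they fold inside `hpt`)
  set c : ℂ := (((eta F n K : ℝ) : ℂ))⁻¹ with hc
  set U0 : W₂ := WL2.equiv ℂ (fun _ : TSite 3 (periodsT3 F K) => c₀) W₂ u y₀ with hU0
  set G0 : W₂ := WL2.equiv ℂ (fun _ : TSite 3 (periodsT3 F K) => c₀) W₂ g y₀ with hG0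
  set A0 : W₂ := adBg F K V (y₀, (0 : Fin 3)) (WL2.equiv ℂ (fun _ : TSite 3 (periodsT3 F K) => c₀) W₂ u (shift (0 : Fin 3) y₀)) with hA0
  set A1 : W₂ := adBg F K V (y₀, (1 : Fin 3)) (WL2.equiv ℂ (fun _ : TSite 3 (periodsT3 F K) => c₀) W₂ u (shift (1 : Fin 3) y₀)) with hA1
  set A2 : W₂ := adBg F K V (y₀, (2 : Fin 3)) (WL2.equiv ℂ (fun _ : TSite 3 (periodsT3 F K) => c₀) W₂ u (shift (2 : Fin 3) y₀)) with hA2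
  set B0 : W₂ := adBgInv F K V (unshift (0 : Fin 3) y₀, (0 : Fin 3))
    (WL2.equiv ℂ (fun _ : TSite 3 (periodsT3 F K) => c₀) W₂ u (unshift (0 : Fin 3) y₀)) with hB0
  set B1 : W₂ := adBgInv F K V (unshift (1 : Fin 3) y₀, (1 : Fin 3))
    (WL2.equiv ℂ (fun _ : TSite 3 (periodsT3 F K) => c₀) W₂ u (unshift (1 : Fin 3) y₀)) with hB1
  set B2 : W₂ := adBgInv F K V (unshift (2 : Fin 3) y₀, (2 : Fin 3))
    (WL2.equiv ℂ (fun _ : TSite 3 (periodsT3 F K) => c₀) W₂ u (unshift (2 : Fin 3) y₀)) with hB2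
  -- rearranged: `(m + 6c²)•u(y₀) = g(y₀) + c²•(A0 + A1 + A2 + B0 + B1 + B2)`
  have key : ((m : ℂ) + 6 * c ^ 2) • U0 = G0 + c ^ 2 • (A0 + A1 + A2 + B0 + B1 + B2) := by
    linear_combination (norm := module) hpt
  -- the scalar `m + 6c²` is the positive real `m + 6ℓ²`
  have hcR : c = (((eta F n K)⁻¹ : ℝ) : ℂ) := by rw [hc, Complex.ofReal_inv]
  have hscal : ((m : ℂ) + 6 * c ^ 2) = (((m + 6 * (eta F n K)⁻¹ ^ 2 : ℝ)) : ℂ) := by rw [hcR]; push_cast; ring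
  have hℓ2 : 0 ≤ (eta F n K)⁻¹ ^ 2 := by positivity
  have hnorm_scal : ‖((m : ℂ) + 6 * c ^ 2)‖ = m + 6 * (eta F n K)⁻¹ ^ 2 := by
    rw [hscal, Complex.norm_real, Real.norm_of_nonneg (by positivity)]
  have hc2 : ‖c ^ 2‖ = (eta F n K)⁻¹ ^ 2 := by
    rw [norm_pow, hcR, Complex.norm_real, Real.norm_of_nonneg (inv_pos.2 (eta_pos F n K)).le]
  -- norms of the transported neighbours (the transporters are isometries)
  have hA0n : ‖A0‖ ≤ ‖U0‖ := by rw [hA0, norm_adBg_eq]; exact hmax _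
  have hA1n : ‖A1‖ ≤ ‖U0‖ := by rw [hA1, norm_adBg_eq]; exact hmax _
  have hA2n : ‖A2‖ ≤ ‖U0‖ := by rw [hA2, norm_adBg_eq]; exact hmax _
  have hB0n : ‖B0‖ ≤ ‖U0‖ := by rw [hB0, norm_adBgInv_eq]; exact hmax _
  have hB1n : ‖B1‖ ≤ ‖U0‖ := by rw [hB1, norm_adBgInv_eq]; exact hmax _
  have hB2n : ‖B2‖ ≤ ‖U0‖ := by rw [hB2, norm_adBgInv_eq]; exact hmax _
  have hS : ‖A0 + A1 + A2 + B0 + B1 + B2‖ ≤ 6 * ‖U0‖ := by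
    have htri : ‖A0 + A1 + A2 + B0 + B1 + B2‖ ≤ ‖A0‖ + ‖A1‖ + ‖A2‖ + ‖B0‖ + ‖B1‖ + ‖B2‖ :=
      (norm_add_le _ _).trans (add_le_add ((norm_add_le _ _).trans (add_le_add ((norm_add_le _ _).trans
        (add_le_add ((norm_add_le _ _).trans (add_le_add (norm_add_le _ _) le_rfl)) le_rfl)) le_rfl)) le_rfl)
    linarith
  -- the maximum principle inequality
  have hineq : (m + 6 * (eta F n K)⁻¹ ^ 2) * ‖U0‖ ≤ Gs + (eta F n K)⁻¹ ^ 2 * (6 * ‖U0‖) := by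
    calc (m + 6 * (eta F n K)⁻¹ ^ 2) * ‖U0‖ = ‖((m : ℂ) + 6 * c ^ 2) • U0‖ := by rw [norm_smul, hnorm_scal]
      _ = ‖G0 + c ^ 2 • (A0 + A1 + A2 + B0 + B1 + B2)‖ := by rw [key]
      _ ≤ ‖G0‖ + ‖c ^ 2‖ * ‖A0 + A1 + A2 + B0 + B1 + B2‖ := (norm_add_le _ _).trans (by rw [norm_smul])
      _ ≤ Gs + (eta F n K)⁻¹ ^ 2 * (6 * ‖U0‖) := add_le_add (hg y₀) (by rw [hc2]; exact mul_le_mul_of_nonneg_left hS hℓ2)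
  have hM : ‖U0‖ ≤ Gs / m := by
    rw [le_div_iff₀ hm]
    nlinarith [norm_nonneg U0]
  intro y
  exact (hmax y).trans hM

/-- ★★ **THE SUP OF `G_m g = (Δ^η_V + m)⁻¹ g` ON SUP DATA**: `‖(G_m g)(y)‖ ≤ G_s∕m` — the maximum principle at `u := greenK (Δ^η_V + m) g`. NO constant, NO regularity, NO room;
the K-free replacement for the `√μ`-carrying Kato sup row when the source is global. [cite: Balaban1985BackgroundPropagators, (3.23) p.394, (3.36)-(3.38) p.396, Thm 3.1 p.397] -/
theorem norm_equiv_greenK_le (V : GaugeField (F.P K) 0 (Matrix.specialUnitaryGroup (Fin 2) ℂ)) {m : ℝ} (hm : 0 < m)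
    (g : SiteL2K ℂ 3 (periodsT3 F K) c₀ W₂) {Gs : ℝ} (hg : ∀ y, ‖WL2.equiv ℂ (fun _ : TSite 3 (periodsT3 F K) => c₀) W₂ g y‖ ≤ Gs) :
    ∀ y, ‖WL2.equiv ℂ (fun _ : TSite 3 (periodsT3 F K) => c₀) W₂
        (greenK (covLapSite F n K c₀ V + (m : ℂ) • LinearMap.id) (covLapSite_add_pos F n K c₀ V hm) g) y‖ ≤ Gs / m := by
  refine norm_equiv_le_of_massive F n K c₀ V hm _ g ?_ hg
  have h := apply_greenK (hpos := covLapSite_add_pos F n K c₀ V hm) g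
  rwa [LinearMap.add_apply, LinearMap.smul_apply, LinearMap.id_apply] at h

/-! ## §3 ★★★ The gradient letter `Hgrad` of `G_m` on sup data, every member -/

variable {ε₀ : ℝ} (hε₀ : 0 < ε₀) (hε1 : ε₀ ≤ 1) (V : GaugeField (F.P K) 0 (Matrix.specialUnitaryGroup (Fin 2) ℂ)) (hreg : RegPr F n K ε₀ V)

include hε₀ hε1 hreg in
/-- ★★★ **`Hgrad` FOR `G_m`, EVERY MEMBER, NO ROOM** ([Balaban1985BackgroundPropagators] Thm 3.1 (3.42): «`|∇_U G f| ≤ O(1) sup|f|`»): for `RegPr F n K ε₀ V`, `0 < ε₀ ≤ 1`, T1-core's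
margin and `m > 0`: `‖(D_V G_m g)(b)‖ ≤ Θ_g(m)·G_s` whenever `‖g(y)‖ ≤ G_s` (`0 ≤ G_s`), with `Θ_g(m) = 2·(C_g·((2 + X)∕m + 2) + 2√2·48ε₀∕m)`,
`X = 2√2·4ε₀(3 + 2457C) + (24√10 + 48)(48ε₀)²`.  PROOF: `u := G_m g` solves `Δ^η_V u + (m•u − g) = D*_V 0`; sups `‖u‖ ≤ G_s∕m` (§2), `‖m•u − g‖ ≤ 2G_s`; then
✓`norm_equiv_DL2_le_of_sup_allMembers`. [cite: Balaban1985BackgroundPropagators, Thm 3.1 (3.42)-(3.44) pp.397-398, p.399 L1-3; Balaban1984PropagatorsII, Lemma 2.1 (2.61)-(2.63) p.234] -/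
theorem Hgrad_of_regPr_allMembers
    (hsmall : exists_curved_localGradient.choose * ((48 * ε₀) * (6 * Real.sqrt 2 * Real.sqrt 10 + 6 * Real.sqrt 2)) ≤ 1 / 2) {m : ℝ} (hm : 0 < m) :
    ∀ (g : SiteL2K ℂ 3 (periodsT3 F K) c₀ W₂) (Gs : ℝ), 0 ≤ Gs → (∀ y, ‖WL2.equiv ℂ _ W₂ g y‖ ≤ Gs) →
      ∀ b, ‖WL2.equiv ℂ _ W₂ (DL2 F n K c₀ V (greenK (covLapSite F n K c₀ V + (m : ℂ) • LinearMap.id) (covLapSite_add_pos F n K c₀ V hm) g)) b‖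
        ≤ (2 * (exists_curved_localGradient.choose *
              ((2 + 2 * Real.sqrt 2 * (4 * ε₀ * (3 + 2457 * norm_bgOfCfg_axialT_sub_le.choose)) + (24 * Real.sqrt 10 + 48) * (48 * ε₀) ^ 2) / m + 2)
            + 2 * Real.sqrt 2 * (48 * ε₀) / m)) * Gs := by
  intro g Gs hGs hg b
  set u : SiteL2K ℂ 3 (periodsT3 F K) c₀ W₂ :=
    greenK (covLapSite F n K c₀ V + (m : ℂ) • LinearMap.id) (covLapSite_add_pos F n K c₀ V hm) g with hu
  -- the equation `(Δ^η_V + m) u = g`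
  have hTu : covLapSite F n K c₀ V u + (m : ℂ) • u = g := by
    have h := apply_greenK (hpos := covLapSite_add_pos F n K c₀ V hm) g
    rwa [LinearMap.add_apply, LinearMap.smul_apply, LinearMap.id_apply] at h
  -- T1-core's equation shape with `q := m•u − g`
  have hq : covLapSite F n K c₀ V u + ((m : ℂ) • u - g) = DstarL2 F n K c₀ V 0 := by
    rw [map_zero, ← add_sub_assoc, hTu, sub_self]
  -- the two sups
  have hMu : ∀ x : TSite 3 (periodsT3 F K), ‖WL2.equiv ℂ (fun _ : TSite 3 (periodsT3 F K) => c₀) W₂ u x‖ ≤ Gs / m :=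
    norm_equiv_le_of_massive F n K c₀ V hm u g hTu hg
  have hMq : ∀ x : TSite 3 (periodsT3 F K), ‖WL2.equiv ℂ (fun _ : TSite 3 (periodsT3 F K) => c₀) W₂ ((m : ℂ) • u - g) x‖ ≤ 2 * Gs := by
    intro x
    rw [WL2.equiv_sub, WL2.equiv_smul, Pi.sub_apply, Pi.smul_apply]
    refine (norm_sub_le _ _).trans ?_
    rw [norm_smul, Complex.norm_real, Real.norm_of_nonneg hm.le]
    have h1 : m * ‖WL2.equiv ℂ (fun _ : TSite 3 (periodsT3 F K) => c₀) W₂ u x‖ ≤ m * (Gs / m) := mul_le_mul_of_nonneg_left (hMu x) hm.le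
    rw [mul_div_cancel₀ _ hm.ne'] at h1
    linarith [hg x]
  have hMu0 : 0 ≤ Gs / m := div_nonneg hGs hm.le
  have hMq0 : 0 ≤ 2 * Gs := by positivity
  have h := norm_equiv_DL2_le_of_sup_allMembers F n K hε₀ hε1 V hreg c₀ u ((m : ℂ) • u - g) hq hMu0 hMq0 hMu hMq hsmall b
  refine h.trans (le_of_eq ?_)
  ring

include hε₀ hε1 hreg in
/-- ★★★ **`Hgrad⁰` — THE `m = 1` EDITION, IN THE CONSUMER'S TOKENS**: the `Hgrad` binder of ✓`Prop7FlatResolventHolderLetterMember.holderRow_G1_DstarL2_of_gauge_and_grad` (and of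
✓`Prop7ResolventHolderRowMember.holderRow_resolventDstarL2_unweighted` at `m := 1`) — `G_1 = greenK (Δ^η_V + ((1 : ℝ) : ℂ)•1) (covLapSite_add_pos … one_pos)` — with the explicit K-free
`Θg := 2·(C_g·(4 + X) + 2√2·48ε₀)`. [cite: Balaban1985BackgroundPropagators, Thm 3.1 (3.42)-(3.44) pp.397-398; Balaban1984PropagatorsII, Lemma 2.1 p.234] -/
theorem Hgrad_one_of_regPr_allMembers
    (hsmall : exists_curved_localGradient.choose * ((48 * ε₀) * (6 * Real.sqrt 2 * Real.sqrt 10 + 6 * Real.sqrt 2)) ≤ 1 / 2) :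
    ∀ (g : SiteL2K ℂ 3 (periodsT3 F K) c₀ W₂) (Gs : ℝ), 0 ≤ Gs → (∀ y, ‖WL2.equiv ℂ _ W₂ g y‖ ≤ Gs) →
      ∀ b, ‖WL2.equiv ℂ _ W₂ (DL2 F n K c₀ V (greenK (covLapSite F n K c₀ V + ((1 : ℝ) : ℂ) • LinearMap.id) (covLapSite_add_pos F n K c₀ V one_pos) g)) b‖
        ≤ (2 * (exists_curved_localGradient.choose *
              (4 + 2 * Real.sqrt 2 * (4 * ε₀ * (3 + 2457 * norm_bgOfCfg_axialT_sub_le.choose)) + (24 * Real.sqrt 10 + 48) * (48 * ε₀) ^ 2)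
            + 2 * Real.sqrt 2 * (48 * ε₀))) * Gs := by
  intro g Gs hGs hg b
  have h := Hgrad_of_regPr_allMembers F n K c₀ hε₀ hε1 V hreg hsmall one_pos g Gs hGs hg b
  refine h.trans (le_of_eq ?_)
  ring

/-- `0 ≤ Θg` for the `m = 1` constant (the consumer's `hΘg` slot): `C_g, C ≥ 0` by their defining existentials. [folklore] -/
theorem Theta_one_nonneg (hε₀' : 0 ≤ ε₀) :
    0 ≤ 2 * (exists_curved_localGradient.choose *
          (4 + 2 * Real.sqrt 2 * (4 * ε₀ * (3 + 2457 * norm_bgOfCfg_axialT_sub_le.choose)) + (24 * Real.sqrt 10 + 48) * (48 * ε₀) ^ 2)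
        + 2 * Real.sqrt 2 * (48 * ε₀)) := by
  have h1 : 0 ≤ exists_curved_localGradient.choose := exists_curved_localGradient.choose_spec.1
  have h2 : 0 ≤ norm_bgOfCfg_axialT_sub_le.choose := norm_bgOfCfg_axialT_sub_le.choose_spec.1
  positivity

end Summit.QuantumFields.YangMills.Theorems.Prop7GreenSupGradientRowAllMembers

end
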